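import Summits.BirchSwinnertonDyer.Rank1Residual.Additive.GordCycLeadingTerm
import Literature.NumberTheory.EllipticCurves.Kato2004.BigImageDivisibilityCyclotomicPrimeComponentOfHalf
import Literature.NumberTheory.EllipticCurves.Wuthrich2014.ReducibleDivisibilityCyclotomicPrimeComponentOfHalf
import HarnessLib

/-!
# The (G)-cell at analytic rank `0`: the cyclotomic leading term `CycLeadingTermAt` is a THEOREM on
# the defect-2 rows (cell `b2b-bsdres`, sub-cell additive-p2, gen 13; companion of `GordCycLeadingTerm`)

HONEST FRAMING (cell `b2b-bsdres`, run/shared/lean/b2b/bsd-rank1-residual/, verbatim in every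
file): the goal of the cell is to DELETE the COMBINATION-SHAPED residual classes of the
Birch–Swinnerton-Dyer formula for ALL analytic-rank `≤ 1` elliptic curves over `ℚ` — "full BSD
formula for every rank `≤ 1` curve in class `C`" assembled STRICTLY from published theorems — so
that the rank-`≤ 1` remainder becomes exactly the CONSTRUCTION-SHAPED classes, which are TYPED
(missing-input `Prop`s), NOT attempted. This is not "finishing BSD". Sub-cell `additive-p2`, gen 13:
research route; no claim beyond the stated classes; X3♯(G-ord)/X4♯(G-ord) stay CONSTRUCTION-SHAPED;
labels / census / located gap UNCHANGED; nothing is booked. Theorems only (no definition, no new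
named fact).

WHAT. `GordCycLeadingTerm.lean` types the ONE rank-`0` input of the Iwasawa route on an additive
(G)-ordinary / (M) row — `CycLeadingTermAt W p`: some `g ∈ char_Λ X(E/ℚ_∞)` has `g(0) = u · L(E,1)/Ω_E`,
`u ∈ ℤ_p^×` — and proves its consumer (upper half of `BSD(E,p)`, every defect, `p ≥ 5`). Here:

* §3 (pointwise, defect 2): the `χ_p`-branch leading terms of additive-p4's lines V9/V9b —
  `g(0) = u·ϖ·∑_{a mod p}(a/p)[a/p]⁺_{f♭}` at `p ≡ 1 (mod 4)`, resp. `u·ϖ⁻·∑(a/p)[a/p]⁻_{f♭}` at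
  `p ≡ 3 (mod 4)`, `f♭` the newform of the semistable twist `E♭` — IMPLY `CycLeadingTermAt W p`, by
  the tree's identities `L(E,1) = ±ϖ·(∑…)·Ω_E` (`entireLFunction_one_eq_of_twist`: Birch + Pal 2012
  Thm. 3.2, named fact `hPal`) and `L(E,1) = ±ϖ⁻·(∑…)·Ω_E/(|u(C)|·c_∞(E))`
  (`entireLFunction_one_eq_of_twist_neg`: odd Birch + Pal for `d < 0`, proved), the correcting
  factors `±1`, `|u(C)|`, `c_∞ ∈ {1,2}` being `p`-adic units (`exists_units_coe_eq_ratCast`).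
* §4 (class level): hence `CycLeadingTermAt W p` HOLDS on X4♯(G-ord) ∩ `I₀*` ∩ {`ρ̄_{E,p}` onto}
  (`p ≥ 5`) from the Kato component reading A124 (`ClassX4Gord.cycLeadingTermAt_of_katoComponent`, via
  gen 12's `chiBranchLeadingTerm[Odd]BigImageAt_of_katoComponent`, the good-ordinary twist model,
  `hmodD`, Serre's lifting) and on X3♯(G-ord) ∩ `I₀*` (odd `p`) from the Wuthrich component reading
  A125 (`ClassX3Gord.cycLeadingTermAt_of_wuthrichComponent`). So the typed input of
  `GordCycLeadingTerm.lean` is the common generalisation of the four discharged branch inputs, and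
  gen 12's rank-`0` consumers (`GordRankZeroKatoComponent.lean`) factor through it on `p ≥ 5`:
  `ClassX4Gord.missingUpperBoundAt_rankZero_of_cycLeadingTerm ∘ ClassX4Gord.cycLeadingTermAt_of_katoComponent`.
  On the defect-`3,4,6` rows the input stays the located gap (module docstring of the companion).
* §5 (the same from the SEMISTABLE component readings): additive-p1's general-`p` "half" facts
  `Wuthrich2014.kato_halfEigenCharIdeal_dvd_cyclotomicPrime_of_surjective` /
  `Wuthrich2014.thm16_halfEigenCharIdeal_dvd_cyclotomicPrime` (Kato 17.4 (3) / Wuthrich Thm. 16 on the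
  component `(p−1)/2` for a SEMISTABLE curve, literature ruling C169) imply A124/A125 in the kernel
  (`…ComponentOfHalf` files), so every theorem of §4 and of gen 12's `GordRankZeroKatoComponent.lean`
  has a variant taking the half fact instead (`…_of_katoHalf`, `…_of_wuthrichHalf`): the cell may
  retire the special-case readings A124/A125 without losing a consumer.

References: Kato 2004 Thm. 17.4 (3) [Kato2004Asterisque]; Wuthrich 2014 Thm. 16 [Wuthrich2014];
Pal 2012 Thm. 3.2 [Pal2012]; Delbourgo 1998 [Delbourgo1998]; Serre 1968/1972 (lifting surjectivity)
[SerreAbelianLadic1968].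
-/

noncomputable section

open scoped Classical MatrixGroups ModularForm NumberField

open CongruenceSubgroup WeierstrassCurve NumberField Literature.NumberTheory.EllipticCurves
  Literature.NumberTheory.EllipticCurves.ModularForms
  Literature.NumberTheory.EllipticCurves.Rank1Residual
  Literature.NumberTheory.EllipticCurves.Rank1Residual.Typed
  IsDedekindDomain Rat.HeightOneSpectrum

namespace Summit.BirchSwinnertonDyer.Rank1Residual.Additive

variable (W : WeierstrassCurve ℚ) [W.IsElliptic] [W.IsGloballyMinimal] (p : ℕ) [hp : Fact p.Prime]

/-! ### §3 Defect 2: the `χ_p`-branch leading terms IMPLY the cyclotomic leading term -/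

omit [W.IsElliptic] [W.IsGloballyMinimal] in
variable {W} in
/-- A non-zero rational number of `p`-adic valuation `0` is (the image of) a unit of `ℤ_p`. -/
theorem exists_units_coe_eq_ratCast {r : ℚ} (hr0 : r ≠ 0) (hv : padicValRat p r = 0) :
    ∃ w : ℤ_[p]ˣ, ((w : ℤ_[p]) : ℚ_[p]) = (r : ℚ_[p]) := by
  have hrQ : ((r : ℚ) : ℚ_[p]) ≠ 0 := by exact_mod_cast hr0
  have hnorm : ‖((r : ℚ) : ℚ_[p])‖ = 1 := by
    rw [Padic.norm_eq_zpow_neg_valuation hrQ, Padic.valuation_ratCast, hv, neg_zero, zpow_zero]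
  exact ⟨PadicInt.mkUnits hnorm, PadicInt.mkUnits_eq hnorm⟩

/-- **Defect 2, `p ≡ 1 (mod 4)`: the even-branch leading term implies `CycLeadingTermAt`.** For
`E = W` additive at `p`, `ℚ`-isomorphic to the twist by `p` of a globally minimal `V = E♭` good or
multiplicative at `p`, `f` the newform of `V`, `ϖ · Ω_V = Ω⁺_f`: if for every dual datum some
`g ∈ char X(E/ℚ_∞)` has `g(0) = u · ϖ · ∑_{a mod p} (a/p)[a/p]⁺_f` (`u ∈ ℤ_p^×`; the pointwise form
of additive-p4's `ChiBranchLeadingTerm[BigImage]At`), then `g(0) = u' · L(E,1)/Ω_E` with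
`u' = ±u`, by the tree's `L(E,1) = ±ϖ·(∑…)·Ω_E` (Birch + Pal 2012 Thm. 3.2, named fact `hPal`).
[cite: Pal2012, Thm. 3.2] -/
theorem cycLeadingTermAt_of_plusLeadingTerm
    (hPal : Pal2012.thm32_sqrt_mul_realPeriodRat_twist_eq_of_prime_one_mod_four)
    (hmod : hasEntireLFunction_rat) (hp4 : p % 4 = 1) (hadd : Addv W p)
    (V : WeierstrassCurve ℚ) [V.IsElliptic] [V.IsGloballyMinimal]
    (hVW : ∃ C : VariableChange ℚ, C • V.quadraticTwist (p : ℚ) = W) (hV : Good V p ∨ Mult V p)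
    {N : ℕ} [NeZero N] {f : CuspForm (Gamma0 N) 2} (hf : IsNewformOf V f)
    (ϖ : ℚ) (hϖ : (ϖ : ℝ) * V.realPeriodRat = plusPeriod f)
    (hLT : ∀ (κ : ZpExtension ℚ p) (γ : Field.absoluteGaloisGroup ℚ),
      κ.IsCyclotomic → κ.IsTopGenerator γ → IsCyclotomicVariable p γ →
      ∀ D : W.SelmerDualData κ γ, ∃ g ∈ D.charIdeal, ∃ u : ℤ_[p]ˣ,
        ((PowerSeries.constantCoeff g : ℤ_[p]) : ℚ_[p]) =
          ((u : ℤ_[p]) : ℚ_[p]) * (ϖ : ℚ_[p]) * (legendrePlusSymbolSum f p : ℚ_[p])) :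
    CycLeadingTermAt W p := by
  intro κ γ hκ hγ hγ' D
  obtain ⟨g, hgmem, u, hg0⟩ := hLT κ γ hκ hγ hγ' D
  obtain ⟨ε, hε, hLq⟩ := entireLFunction_one_eq_of_twist p hPal hmod hp4 V W hVW hV hadd hf ϖ hϖ
  have hε0 : ε ≠ 0 := by rcases hε with rfl | rfl <;> norm_num
  have hεv : padicValRat p ε = 0 := by
    rcases hε with rfl | rfl
    · exact padicValRat.one
    · rw [padicValRat.neg]; exact padicValRat.one
  obtain ⟨w, hw⟩ := exists_units_coe_eq_ratCast p hε0 hεv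
  have hε2 : ((ε : ℚ) : ℚ_[p]) ^ 2 = 1 := by rcases hε with rfl | rfl <;> norm_num
  refine ⟨g, hgmem, u * w, ε * (ϖ * legendrePlusSymbolSum f p), hLq, ?_⟩
  rw [hg0, Units.val_mul, PadicInt.coe_mul, hw]
  push_cast
  linear_combination
    (-(((u : ℤ_[p]) : ℚ_[p]) * (ϖ : ℚ_[p]) * (legendrePlusSymbolSum f p : ℚ_[p]))) * hε2

/-- **Defect 2, `p ≡ 3 (mod 4)`: the odd-branch leading term implies `CycLeadingTermAt`.** For
`E = W = C • V^{(−p)}` additive at `p`, `V = E♭` globally minimal good or multiplicative at `p` with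
`ord_p u(C) = 0`, `f` the newform of `V`, `ϖ⁻ · |Ω⁻(V)| = Ω⁻_f`: if for every dual datum some
`g ∈ char X(E/ℚ_∞)` has `g(0) = u · ϖ⁻ · ∑_{a mod p} (a/p)[a/p]⁻_f`, then `g(0) = u' · L(E,1)/Ω_E`
with `u' = ±u·|u(C)|·c_∞(E) ∈ ℤ_p^×`, by the tree's odd Birch + Pal (`d < 0`, PROVED) identity
`L(E,1) = ±ϖ⁻·(∑…)·Ω_E/(|u(C)|·c_∞(E))`. -/
theorem cycLeadingTermAt_of_minusLeadingTerm (hmod : hasEntireLFunction_rat) (hp4 : p % 4 = 3)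
    (hadd : Addv W p) (V : WeierstrassCurve ℚ) [V.IsElliptic] [V.IsGloballyMinimal]
    (C : VariableChange ℚ) (hC : C • V.quadraticTwist (-(p : ℚ)) = W)
    (hu : padicValRat p (C.u : ℚ) = 0)
    {N : ℕ} [NeZero N] {f : CuspForm (Gamma0 N) 2} (hf : IsNewformOf V f)
    (ϖ : ℚ) (hϖ : (ϖ : ℝ) * V.imaginaryPeriodRat = minusPeriod f)
    (hLT : ∀ (κ : ZpExtension ℚ p) (γ : Field.absoluteGaloisGroup ℚ),
      κ.IsCyclotomic → κ.IsTopGenerator γ → IsCyclotomicVariable p γ →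
      ∀ D : W.SelmerDualData κ γ, ∃ g ∈ D.charIdeal, ∃ u : ℤ_[p]ˣ,
        ((PowerSeries.constantCoeff g : ℤ_[p]) : ℚ_[p]) =
          ((u : ℤ_[p]) : ℚ_[p]) * (ϖ : ℚ_[p]) * (legendreMinusSymbolSum f p : ℚ_[p])) :
    CycLeadingTermAt W p := by
  have hp2 : p ≠ 2 := by omega
  intro κ γ hκ hγ hγ' D
  obtain ⟨g, hgmem, u, hg0⟩ := hLT κ γ hκ hγ hγ' D
  obtain ⟨ε, hε, hLq⟩ := entireLFunction_one_eq_of_twist_neg p hmod hp4 V W C hC hadd hf ϖ hϖ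
  set S : ℚ := legendreMinusSymbolSum f p with hS
  set cinf : ℕ := (W.baseChange ℝ).numRealComponents with hcinf
  -- the correcting factor `ε · |u(C)| · c_∞` is a `p`-adic unit
  have hε0 : ε ≠ 0 := by rcases hε with rfl | rfl <;> norm_num
  have hεv : padicValRat p ε = 0 := by
    rcases hε with rfl | rfl
    · exact padicValRat.one
    · rw [padicValRat.neg]; exact padicValRat.one
  have hua0 : |(C.u : ℚ)| ≠ 0 := abs_ne_zero.mpr C.u.ne_zero
  have hcinf0 : (cinf : ℚ) ≠ 0 := by
    rw [hcinf, numRealComponents]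
    split_ifs <;> norm_num
  have hvua : padicValRat p |(C.u : ℚ)| = 0 := by
    rcases abs_choice (C.u : ℚ) with h | h
    · rw [h]; exact hu
    · rw [h, padicValRat.neg]; exact hu
  have hd0 : ε * (|(C.u : ℚ)| * (cinf : ℚ)) ≠ 0 := mul_ne_zero hε0 (mul_ne_zero hua0 hcinf0)
  have hdv : padicValRat p (ε * (|(C.u : ℚ)| * (cinf : ℚ))) = 0 := by
    rw [padicValRat.mul hε0 (mul_ne_zero hua0 hcinf0), padicValRat.mul hua0 hcinf0, hεv, hvua,
      hcinf, padicValRat_numRealComponents_eq_zero W p hp2]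
    norm_num
  obtain ⟨w, hw⟩ := exists_units_coe_eq_ratCast p hd0 hdv
  -- the identity `ϖ⁻ S⁻ = (ε |u(C)| c_∞) · (ε ϖ⁻ S⁻ / (|u(C)| c_∞))` in `ℚ` (`ε² = 1`)
  have key : ϖ * S =
      (ε * (|(C.u : ℚ)| * (cinf : ℚ))) * (ε * (ϖ * S) / (|(C.u : ℚ)| * (cinf : ℚ))) := by
    have hε2Q : ε ^ 2 = 1 := by rcases hε with rfl | rfl <;> norm_num
    have hdinv : (|(C.u : ℚ)| * (cinf : ℚ)) * (|(C.u : ℚ)| * (cinf : ℚ))⁻¹ = 1 :=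
      mul_inv_cancel₀ (mul_ne_zero hua0 hcinf0)
    rw [div_eq_mul_inv]
    linear_combination (-(ϖ * S)) * hε2Q + (-(ϖ * S * ε ^ 2)) * hdinv
  refine ⟨g, hgmem, u * w, _, hLq, ?_⟩
  rw [hg0, Units.val_mul, PadicInt.coe_mul, hw, mul_assoc, mul_assoc, ← Rat.cast_mul,
    ← Rat.cast_mul, ← key]

/-! ### §4 Defect 2: `CycLeadingTermAt` is a THEOREM from the component readings (gen 12's chain) -/

/-- **X4♯(G-ord) ∩ `I₀*` ∩ {`ρ̄_{E,p}` onto}, `p ≥ 5`: `CycLeadingTermAt W p` HOLDS** — from the Kato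
component reading A124 (`hK`, Kato 2004 Thm. 17.4 (3) on the `ω^{(p−1)/2}`-component) through gen 12's
discharged branch inputs `chiBranchLeadingTerm[Odd]BigImageAt_of_katoComponent`, the good-ordinary
twist model `E♭` (`ClassX4Gord.exists_goodOrd_pStar_twist_model`), the newform and period ratios of
`E♭` (`hmodD`), Serre's lifting of mod-`p` to `p`-adic surjectivity for `p ≥ 5`, and §3. So on the
defect-2 rows gen 12's rank-0 consumers factor through the cyclotomic leading term:
`ClassX4Gord.missingUpperBoundAt_rankZero_of_cycLeadingTerm ∘ (this)`.
[cite: Kato2004Asterisque, Thm. 17.4 (3) (p. 273)] [cite: Pal2012, Thm. 3.2] -/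
theorem ClassX4Gord.cycLeadingTermAt_of_katoComponent
    (hK : Kato2004.charIdeal_dvd_padicLFunctionBranch_component_of_surjective)
    (hPal : Pal2012.thm32_sqrt_mul_realPeriodRat_twist_eq_of_prime_one_mod_four)
    (hmod : hasEntireLFunction_rat) (hmodD : nonempty_modularParametrizationData)
    (hX : ClassX4Gord W p) (hp5 : 5 ≤ p) (he : semistabilityIndex W p = 2) (hsurj : Surj W p) :
    CycLeadingTermAt W p := by
  obtain ⟨V, iV, iVm, C, hV, hC⟩ := hX.exists_goodOrd_pStar_twist_model W p he
  haveI : NeZero (V.conductorNorm ℤ) := ⟨(V.conductorNorm_pos_holds).ne'⟩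
  obtain ⟨Dm⟩ := hmodD V
  obtain ⟨ϖ, -, hϖ, -⟩ := Dm.exists_rat_mul_realPeriodRat_eq_plusPeriod
  obtain ⟨ϖ', -, hϖ'⟩ := exists_rat_mul_imaginaryPeriodRat_eq_minusPeriod Dm
  have hj := padicValRat_j_nonneg_of_typeGOrd W p hX.typeGOrd
  have hBCeven := chiBranchLeadingTermBigImageAt_of_katoComponent W p hK hj
  have hBCodd := chiBranchLeadingTermOddBigImageAt_of_katoComponent W p hK hj
  have hsurjV : ∀ n : ℕ, V.HasSurjectiveModNGaloisRep (p ^ n : ℕ) :=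
    X4RankZeroTwistOdd.forall_surj_pow_twist_of_surj W p hp5 V (pStar_ne_zero p) C hC hsurj
  have hodd : p % 4 = 1 ∨ p % 4 = 3 := by
    obtain ⟨k, hk⟩ := hp.out.odd_of_ne_two (by omega)
    omega
  rcases hodd with h1 | h3
  · have hC' : C • V.quadraticTwist (p : ℚ) = W := by
      rw [pStar_eq_of_mod_four p (Or.inl h1), if_pos h1] at hC
      exact hC
    exact cycLeadingTermAt_of_plusLeadingTerm W p hPal hmod h1 hX.addv.2 V ⟨C, hC'⟩ (Or.inl hV.1)
      Dm.isNewformOf ϖ hϖ fun _ _ hκ hγ hγ' D ↦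
        (hBCeven V h1 ⟨C, hC'⟩ (Or.inl hV) hsurjV hκ hγ hγ' Dm.isNewformOf D ϖ hϖ).2
  · have hC' : C • V.quadraticTwist (-(p : ℚ)) = W := by
      rw [pStar_eq_of_mod_four p (Or.inr h3), if_neg (by omega)] at hC
      exact hC
    have hC'' : C • V.quadraticTwist (((-(p : ℤ)) : ℤ) : ℚ) = W := by push_cast; exact hC'
    have huC : padicValRat p (C.u : ℚ) = 0 :=
      padicValRat_u_eq_zero_of_twist_pm_p p (by omega) V W (Or.inl hV.1) (Or.inr rfl) C hC''
    exact cycLeadingTermAt_of_minusLeadingTerm W p hmod h3 hX.addv.2 V C hC' huC Dm.isNewformOf ϖ'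
      hϖ' fun _ _ hκ hγ hγ' D ↦
        (hBCodd V h3 ⟨C, hC'⟩ (Or.inl hV) hsurjV hκ hγ hγ' Dm.isNewformOf D ϖ' hϖ').2

/-- **X3♯(G-ord) ∩ `I₀*`, odd `p`: `CycLeadingTermAt W p` HOLDS** — from the Wuthrich component
reading A125 (`hWu`, Wuthrich 2014 Thm. 16 on the `ω^{(p−1)/2}`-component, `E♭[p]` reducible) through
gen 12's `chiBranchLeadingTerm[Odd]At_of_wuthrichComponent`, the twist model, `hmodD` and §3.
[cite: Wuthrich2014, Thm. 16 (p. 397)] [cite: Pal2012, Thm. 3.2] -/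
theorem ClassX3Gord.cycLeadingTermAt_of_wuthrichComponent
    (hWu : Wuthrich2014.charIdeal_dvd_padicLFunctionBranch_component)
    (hPal : Pal2012.thm32_sqrt_mul_realPeriodRat_twist_eq_of_prime_one_mod_four)
    (hmod : hasEntireLFunction_rat) (hmodD : nonempty_modularParametrizationData)
    (hp2 : p ≠ 2) (hX : ClassX3Gord W p) (he : semistabilityIndex W p = 2) :
    CycLeadingTermAt W p := by
  obtain ⟨V, iV, iVm, C, hV, hC⟩ := hX.exists_goodOrd_pStar_twist_model W p hp2 he
  haveI : NeZero (V.conductorNorm ℤ) := ⟨(V.conductorNorm_pos_holds).ne'⟩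
  obtain ⟨Dm⟩ := hmodD V
  obtain ⟨ϖ, -, hϖ, -⟩ := Dm.exists_rat_mul_realPeriodRat_eq_plusPeriod
  obtain ⟨ϖ', -, hϖ'⟩ := exists_rat_mul_imaginaryPeriodRat_eq_minusPeriod Dm
  have hj := padicValRat_j_nonneg_of_typeGOrd W p hX.typeGOrd
  have hBCeven := chiBranchLeadingTermAt_of_wuthrichComponent W p hWu hj
  have hBCodd := chiBranchLeadingTermOddAt_of_wuthrichComponent W p hWu hj
  have hodd : p % 4 = 1 ∨ p % 4 = 3 := by
    obtain ⟨k, hk⟩ := hp.out.odd_of_ne_two hp2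
    omega
  rcases hodd with h1 | h3
  · have hC' : C • V.quadraticTwist (p : ℚ) = W := by
      rw [pStar_eq_of_mod_four p (Or.inl h1), if_pos h1] at hC
      exact hC
    exact cycLeadingTermAt_of_plusLeadingTerm W p hPal hmod h1 hX.addv V ⟨C, hC'⟩ (Or.inl hV.1)
      Dm.isNewformOf ϖ hϖ fun _ _ hκ hγ hγ' D ↦
        (hBCeven V h1 ⟨C, hC'⟩ (Or.inl hV) hX.classX3.1 hκ hγ hγ' Dm.isNewformOf D ϖ hϖ).2
  · have hC' : C • V.quadraticTwist (-(p : ℚ)) = W := by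
      rw [pStar_eq_of_mod_four p (Or.inr h3), if_neg (by omega)] at hC
      exact hC
    have hC'' : C • V.quadraticTwist (((-(p : ℤ)) : ℤ) : ℚ) = W := by push_cast; exact hC'
    have huC : padicValRat p (C.u : ℚ) = 0 :=
      padicValRat_u_eq_zero_of_twist_pm_p p hp2 V W (Or.inl hV.1) (Or.inr rfl) C hC''
    exact cycLeadingTermAt_of_minusLeadingTerm W p hmod h3 hX.addv V C hC' huC Dm.isNewformOf ϖ'
      hϖ' fun _ _ hκ hγ hγ' D ↦
        (hBCodd V h3 ⟨C, hC'⟩ (Or.inl hV) hX.classX3.1 hκ hγ hγ' Dm.isNewformOf D ϖ' hϖ').2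

/-! ### §5 The same from the SEMISTABLE component readings (additive-p1's "half" facts, C169) -/

/-- **X4♯(G-ord) ∩ `I₀*` ∩ {`ρ̄` onto}, `p ≥ 5`: `CycLeadingTermAt W p` from the semistable big-image
component reading** `Wuthrich2014.kato_halfEigenCharIdeal_dvd_cyclotomicPrime_of_surjective` (whose
good-ordinary clause is A124, kernel bridge `…_of_surjective_of_half`).
[cite: Kato2004Asterisque, Thm. 17.4 (3) (p. 273)] -/
theorem ClassX4Gord.cycLeadingTermAt_of_katoHalf
    (hK : Wuthrich2014.kato_halfEigenCharIdeal_dvd_cyclotomicPrime_of_surjective)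
    (hPal : Pal2012.thm32_sqrt_mul_realPeriodRat_twist_eq_of_prime_one_mod_four)
    (hmod : hasEntireLFunction_rat) (hmodD : nonempty_modularParametrizationData)
    (hX : ClassX4Gord W p) (hp5 : 5 ≤ p) (he : semistabilityIndex W p = 2) (hsurj : Surj W p) :
    CycLeadingTermAt W p :=
  ClassX4Gord.cycLeadingTermAt_of_katoComponent W p
    (Kato2004.charIdeal_dvd_padicLFunctionBranch_component_of_surjective_of_half hK) hPal hmod hmodD
    hX hp5 he hsurj

/-- **X3♯(G-ord) ∩ `I₀*`, odd `p`: `CycLeadingTermAt W p` from the semistable reducible component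
reading** `Wuthrich2014.thm16_halfEigenCharIdeal_dvd_cyclotomicPrime` (whose good-ordinary clause is
A125, kernel bridge `…_of_half`). [cite: Wuthrich2014, Thm. 16 (p. 397)] -/
theorem ClassX3Gord.cycLeadingTermAt_of_wuthrichHalf
    (hWu : Wuthrich2014.thm16_halfEigenCharIdeal_dvd_cyclotomicPrime)
    (hPal : Pal2012.thm32_sqrt_mul_realPeriodRat_twist_eq_of_prime_one_mod_four)
    (hmod : hasEntireLFunction_rat) (hmodD : nonempty_modularParametrizationData)
    (hp2 : p ≠ 2) (hX : ClassX3Gord W p) (he : semistabilityIndex W p = 2) :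
    CycLeadingTermAt W p :=
  ClassX3Gord.cycLeadingTermAt_of_wuthrichComponent W p
    (Wuthrich2014.charIdeal_dvd_padicLFunctionBranch_component_of_half hWu) hPal hmod hmodD hp2 hX he

variable {W p} in
/-- **X4♯(G-ord) ∩ `I₀*` ∩ {`ρ̄` onto}, `r_an = 0`, EVERY odd `p` (`ram(3)` at `p = 3`): the UPPER
half `ord_p #Ш(E) ≤ ord_p #Ш_an(E)` from the semistable big-image component reading** — gen 12's
`ClassX4Gord.missingUpperBoundAt_rankZero_of_katoComponent` re-based on additive-p1's half fact
(retirement path for A124). [cite: Kato2004Asterisque, Thm. 17.4 (3) (p. 273)]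
[cite: Delbourgo1998, Prop. 4 (p. 144)] -/
theorem ClassX4Gord.missingUpperBoundAt_rankZero_of_katoHalf
    (hK : Wuthrich2014.kato_halfEigenCharIdeal_dvd_cyclotomicPrime_of_surjective)
    (hDel : Delbourgo1998.prop4_rankZero_pow_dvd_constantCoeff)
    (hGZK : rank_eq_analyticRank_of_analyticRank_le_one) (hmod : hasEntireLFunction_rat)
    (hmodD : nonempty_modularParametrizationData)
    (hX : ClassX4Gord W p) (he : semistabilityIndex W p = 2) (hr : W.analyticRank = 0)
    (hsurj : Surj W p) (hram3 : p = 3 → Ram W p) :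
    MissingUpperBoundAt W p :=
  ClassX4Gord.missingUpperBoundAt_rankZero_of_katoComponent
    (Kato2004.charIdeal_dvd_padicLFunctionBranch_component_of_surjective_of_half hK) hDel hGZK hmod
    hmodD hX he hr hsurj hram3

variable {W p} in
/-- **X3♯(G-ord) ∩ `I₀*` (odd `p`), `r_an = 0`: the UPPER half from the semistable reducible component
reading** — gen 12's `ClassX3Gord.missingUpperBoundAt_rankZero_of_wuthrichComponent` re-based on
additive-p1's half fact (retirement path for A125). [cite: Wuthrich2014, Thm. 16 (p. 397)]
[cite: Delbourgo1998, Prop. 4 (p. 144)] -/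
theorem ClassX3Gord.missingUpperBoundAt_rankZero_of_wuthrichHalf
    (hWu : Wuthrich2014.thm16_halfEigenCharIdeal_dvd_cyclotomicPrime)
    (hDel : Delbourgo1998.prop4_rankZero_pow_dvd_constantCoeff)
    (hGZK : rank_eq_analyticRank_of_analyticRank_le_one) (hmod : hasEntireLFunction_rat)
    (hmodD : nonempty_modularParametrizationData)
    (hp2 : p ≠ 2) (hX : ClassX3Gord W p) (he : semistabilityIndex W p = 2) (hr : W.analyticRank = 0) :
    MissingUpperBoundAt W p :=
  ClassX3Gord.missingUpperBoundAt_rankZero_of_wuthrichComponent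
    (Wuthrich2014.charIdeal_dvd_padicLFunctionBranch_component_of_half hWu) hDel hGZK hmod hmodD hp2
    hX he hr

end Summit.BirchSwinnertonDyer.Rank1Residual.Additive

end
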